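import Mathlib

/-!
# Tier3SplittingCompatibility — «compatibility (1) DEFINES `χ_V`, admissible without condition since `dim V = 2`
is even» (T3.5 for T3.1; PERIOD.md §4.7, last sentence; §5 (1), §5(C))

Blind re-derivation cell `pub-hodge-repro`, seat `t3-p1` (Tier 3, T3.5 Lean item beside T3.1). Target tree path
`lean/Summits/Ventures/HodgeRepro/Tier3SplittingCompatibility.lean`; Mathlib only; theorems only (no definition,
instance, notation or macro). The candidate t3-p1 g15 left named in its HANDOFF («the §4.7 χ_V-definition sentence …
solvability + restriction, trivial, ≈ 10 lines»), filed by g16 so that the §4.7 chain has no untwinned sentence.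

`proofs/t3-p1/PERIOD.md` §4.7 ends: «Finally TP1's compatibility (1) `β = (χ_W^{-2}χ_V)∘j^{-1}·(χ₀χ₁)|_Z` DEFINES
`χ_V := (β·χ_W²·(χ₀χ₁)^{-1})∘j` as a character of `U(1)(𝔸)/U(1)(E′) ≅ 𝔸_{E′}^×/E′^×𝔸_{E′⁺}^×` — admissible without
condition since `dim V_λ = 2` is even (`χ_V|_{𝔸_{E′⁺}^×} = ε² = 1`)». Vocabulary: `G` the idele group `𝔸_{E′}^×`,
`A ≤ G` the subgroup `𝔸_{E′⁺}^×` on which the splitting conditions are stated, `U` the group `U(1)(𝔸)` (the centre `Z`),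
`j : G →* U` the map `x ↦ x/x̄` (trivial on `A`: `x̄ = x` there — the algebraic half is `Tier3NormOneHilbert90`),
`β γ : U →* M` the characters `β` and `γ := (χ₀χ₁)|_Z`, `χ_W : G →* M` the splitting character of the line with
`χ_W|_A = ε`, `ε² = 1` (PERIOD.md §5(B): «`χ_W|_{k^×} = ε^{dim W} = ε`»). Compatibility (1), read on `G` through
`j`, is the identity of characters `β ∘ j = χ_W⁻² · χ_V · (γ ∘ j)`. This file is the sentence, one theorem per clause:

* `compat_of_eq` — the DEFINITION solves (1): `χ_V := χ_W² · ((β · γ⁻¹) ∘ j)` satisfies `β ∘ j = χ_W⁻² · χ_V · (γ ∘ j)`;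
* `eq_of_compat` — and it is the ONLY solution: any `χ_V'` with `β ∘ j = χ_W⁻² · χ_V' · (γ ∘ j)` equals it («DEFINES»);
* `exists_unique_compat` — the two together, as a unique-existence statement;
* `exists_descent` — the quotient `χ_W⁻² · χ_V` factors through `j` («`(χ_W^{-2}χ_V)∘j^{-1}`» makes sense: it is
  `β · γ⁻¹` on `U`);
* `restrict_comp_eq_one_of_le_ker` — a character pulled back along `j` is trivial on `A ≤ ker j`;
* `restrict_pow_eq_one_of_even` — `χ_W^{2n}` is trivial on `A` when `χ_W|_A = ε` and `ε² = 1` («`dim V` even»);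
* `restrict_eq_one` — THE ADMISSIBILITY: the defined `χ_V` restricts to `1` on `A` (`χ_V|_{𝔸_{E′⁺}^×} = ε² = 1`), with no
  condition on `β`, `γ` or `χ_W` beyond `χ_W|_A = ε`, `ε² = 1`.

What stays on the page: that the conditions on a splitting datum for `(U(L), U(W))` are exactly `χ_W|_A = ε^{dim L}`,
`χ_V|_A = ε^{dim V}` (Kudla's splitting characters as TP1 uses them), the identification `U(1)(𝔸)/U(1)(E′) ≅
𝔸_{E′}^×/E′^×𝔸_{E′⁺}^×` (Hilbert 90, `Tier3NormOneHilbert90`), and the existence of `β` with the archimedean type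
of §4.7 (`Tier3PrescribedExponents`). Nothing here is about root numbers or `L`-values; HC_CM is NOT proved by anyone
in this repository.
-/

set_option autoImplicit false

namespace HodgeRepro.T3P1.SplittingCompatibility

section Compatibility

variable {G U M : Type*} [CommGroup G] [CommGroup U] [CommGroup M]

/-- **The definition solves (1).** `χ_V := χ_W² · ((β · γ⁻¹) ∘ j)` satisfies `β ∘ j = χ_W⁻² · χ_V · (γ ∘ j)`
(PERIOD.md §4.7: «compatibility (1) … DEFINES `χ_V := (β·χ_W²·(χ₀χ₁)^{-1})∘j`»). -/
theorem compat_of_eq (j : G →* U) (β γ : U →* M) (χ_W : G →* M) :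
    β.comp j = χ_W⁻¹ ^ 2 * (χ_W ^ 2 * (β * γ⁻¹).comp j) * γ.comp j := by
  rw [MonoidHom.mul_comp, MonoidHom.inv_comp, inv_pow, ← mul_assoc, inv_mul_cancel, one_mul,
    inv_mul_cancel_right]

/-- **Uniqueness.** Any `χ_V'` with `β ∘ j = χ_W⁻² · χ_V' · (γ ∘ j)` is `χ_W² · ((β · γ⁻¹) ∘ j)` — compatibility (1)
DEFINES `χ_V`. -/
theorem eq_of_compat (j : G →* U) (β γ : U →* M) (χ_W χ_V' : G →* M)
    (h : β.comp j = χ_W⁻¹ ^ 2 * χ_V' * γ.comp j) :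
    χ_V' = χ_W ^ 2 * (β * γ⁻¹).comp j := by
  rw [MonoidHom.mul_comp, MonoidHom.inv_comp, h, mul_inv_cancel_right, inv_pow, ← mul_assoc,
    mul_inv_cancel, one_mul]

/-- **Unique existence**: there is exactly one character `χ_V` of `G` satisfying compatibility (1) for the given
`β`, `γ`, `χ_W` and `j`. -/
theorem exists_unique_compat (j : G →* U) (β γ : U →* M) (χ_W : G →* M) :
    ∃! χ_V : G →* M, β.comp j = χ_W⁻¹ ^ 2 * χ_V * γ.comp j :=
  ⟨χ_W ^ 2 * (β * γ⁻¹).comp j, compat_of_eq j β γ χ_W, fun χ_V' h => eq_of_compat j β γ χ_W χ_V' h⟩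

/-- **Descent**: for the defined `χ_V`, the quotient `χ_W⁻² · χ_V` is a character pulled back along `j` — the
`(χ_W^{-2}χ_V)∘j^{-1}` of (1) is `β · γ⁻¹` on `U`. -/
theorem exists_descent (j : G →* U) (β γ : U →* M) (χ_W : G →* M) :
    ∃ δ : U →* M, δ.comp j = χ_W⁻¹ ^ 2 * (χ_W ^ 2 * (β * γ⁻¹).comp j) := by
  refine ⟨β * γ⁻¹, ?_⟩
  rw [inv_pow, ← mul_assoc, inv_mul_cancel, one_mul]

end Compatibility

section Admissibility

variable {G U M : Type*} [CommGroup G] [CommGroup U] [CommGroup M]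

/-- A character pulled back along `j` is trivial on a subgroup `A ≤ ker j` («`j` kills `𝔸_{E′⁺}^×`: `x̄ = x`
there»). -/
theorem restrict_comp_eq_one_of_le_ker (j : G →* U) (A : Subgroup G) (hA : A ≤ j.ker) (δ : U →* M) :
    (δ.comp j).restrict A = 1 := by
  ext ⟨a, ha⟩
  have h : j a = 1 := hA ha
  simp [MonoidHom.restrict_apply, h]

/-- An EVEN power of the line's splitting character is trivial on `A`: `χ_W|_A = ε` and `ε² = 1` give
`χ_W^{2n}|_A = 1` («admissible without condition since `dim V = 2` is even»). -/
theorem restrict_pow_eq_one_of_even (A : Subgroup G) (χ_W : G →* M) (ε : A →* M)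
    (hW : χ_W.restrict A = ε) (hε : ε ^ 2 = 1) (n : ℕ) : (χ_W ^ (2 * n)).restrict A = 1 := by
  ext a
  have h := congrArg (fun f : A →* M => f a) hε
  simp only [MonoidHom.pow_apply, MonoidHom.one_apply] at h
  have hWa : χ_W a = ε a := by
    have := congrArg (fun f : A →* M => f a) hW
    simpa [MonoidHom.restrict_apply] using this
  simp only [MonoidHom.restrict_apply, MonoidHom.pow_apply, MonoidHom.one_apply, hWa, pow_mul, h,
    one_pow]

/-- **Admissibility of the defined `χ_V`.** With `A ≤ ker j`, `χ_W|_A = ε` and `ε² = 1`, the character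
`χ_V := χ_W² · ((β · γ⁻¹) ∘ j)` of compatibility (1) restricts to `1` on `A` — «`χ_V|_{𝔸_{E′⁺}^×} = ε² = 1`», with no
further condition on `β` or on `γ = (χ₀χ₁)|_Z`. -/
theorem restrict_eq_one (j : G →* U) (A : Subgroup G) (hA : A ≤ j.ker) (β γ : U →* M) (χ_W : G →* M)
    (ε : A →* M) (hW : χ_W.restrict A = ε) (hε : ε ^ 2 = 1) :
    (χ_W ^ 2 * (β * γ⁻¹).comp j).restrict A = 1 := by
  have h1 : (χ_W ^ 2).restrict A = 1 := by
    simpa using restrict_pow_eq_one_of_even A χ_W ε hW hε 1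
  have h2 : ((β * γ⁻¹).comp j).restrict A = 1 := restrict_comp_eq_one_of_le_ker j A hA (β * γ⁻¹)
  ext a
  have e1 := congrArg (fun f : A →* M => f a) h1
  have e2 := congrArg (fun f : A →* M => f a) h2
  simp only [MonoidHom.restrict_apply, MonoidHom.one_apply] at e1 e2
  simp [MonoidHom.restrict_apply, e1, e2]

end Admissibility

end HodgeRepro.T3P1.SplittingCompatibility
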